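import Summits.Ventures.LatticeQCDFlow.Scaling.WarmStartCeiling

/-!
HONEST FRAMING: exact (Metropolis-corrected) sampling algorithms for lattice gauge theory; figures
of merit are autocorrelation/cost numbers at stated couplings and volumes; no continuum-physics
claim.

# WarmStartPerfect — RE-EQUILIBRATION AFTER A PERTURBATION WITH PERFECT TRANSPORTS: THE HOT-REFRESHED HUB WITH
# `μ_{l_r} ∘ φ_r = μ_0` (ANY LAWS, MAPS, WEIGHTS, `0 < t < 1`, `w_0 > 0`) STARTED WITH THE REPLICAS OF `D₀` PINNED AND THE
# REST EXACT IS WITHIN `2·#D₀·(1 − t(1−t)w_0c/(2m))ⁿ` OF `π̃` AT TIME `n` — NO REGIME CONDITION, `log #D₀` IN PLACE OF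
# `log K` (lean-2 GEN-26, ours)

Venture-side (OURS).  Cell `lqcd-flow` (pub-lqcd), unit `pub-lqcd-lean-2-g26`, 2026-08-27.  Chapter M, file 25 — the
perfect-transport companion of `Scaling/WarmStartCeiling` (same pinned product start `λ₀`, tag chain from `δ_{D₀}` with
the perfect-transport tuning `b = 1 − (1−t)w_0/2`, `ρ = t(1−t)w_0c/(2m)` of `Scaling/RegenerationTagDecay`).

## What is proved

* **`warmStart_perfect_tvDist_le`** — **`‖λ₀Pⁿ − π̃‖_TV ≤ 2·#D₀·(1 − t(1−t)w_0c/(2m))ⁿ`**.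

NOT CLAIMED: starts that are not exact off `D₀`; anything measured.  Literature grade (cell rule): OWN RESULT; nothing
cited as a fact; no new bib keys.
-/

noncomputable section

open Finset Function
open Literature.Probability.MarkovChains

namespace Summit.Ventures.LatticeQCDFlow.Scaling

variable {S : Type*} [Fintype S] [DecidableEq S] {K m : ℕ} {μ : Fin (K + 1) → S → ℝ} {M : Fin (K + 1) → S → S → ℝ}
  {w : Fin (K + 1) → ℝ} {t : ℝ}

section WarmPerfect
variable (κ : Fin m → Fin K) (φ : Fin m → Equiv.Perm S)

/-- **THE WARM START WITH PERFECT TRANSPORTS:** `μ_{l_r}(φ_r u) = μ_0(u)`, `0 < t < 1`, `w_0 > 0`, any laws, maps and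
weights, exact hot sampler, stationary cold kernels, hub multiplicities `≥ c ≥ 1`, the pinned start on `D₀`:
**`‖λ₀Pⁿ − π̃‖_TV ≤ 2·#D₀·(1 − t(1−t)w_0c/(2m))ⁿ`** (no regime condition). [ours] -/
theorem warmStart_perfect_tvDist_le (hm : 1 ≤ m) (ht0 : 0 < t) (ht1 : t < 1) (hw0 : ∀ k, 0 ≤ w k) (hw00 : 0 < w 0)
    (hw1 : ∑ k, w k = 1) (hμ : ∀ k x, 0 < μ k x) (hμ1 : ∀ k, ∑ u, μ k u = 1) (hM : ∀ k, IsRowStochastic (M k))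
    (hM0 : ∀ u v, M 0 u v = μ 0 v) (hstat : ∀ k : Fin (K + 1), k ≠ 0 → ∀ v, ∑ u, μ k u * M k u v = μ k v)
    (hperf : ∀ r u, μ (κ r).succ (φ r u) = μ 0 u)
    {c : ℕ} (hc1 : 1 ≤ c) (hc : ∀ p' : Fin K, c ≤ (univ.filter (fun r : Fin m => κ r = p')).card) (hcm : c ≤ m)
    (D₀ : Finset (Fin (K + 1))) (x : Fin (K + 1) → S)
    {g : Fin (K + 1) → S → ℝ} (hg' : ∀ j u, g j u = if j ∈ D₀ then (if u = x j then (1 : ℝ) else 0) else μ j u)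
    (n : ℕ) :
    tvDist (lawAt (fun y z : Fin (K + 1) → S =>
          t * ptGraphSwap μ (fun r : Fin m => (((0 : Fin (K + 1)), (κ r).succ) : Fin (K + 1) × Fin (K + 1))) φ y z
          + (1 - t) * prodKernel w M y z) (tensorFun g) n) (tensorFun μ)
      ≤ 2 * (D₀.card : ℝ) * (1 - t * (1 - t) * w 0 * c / (2 * m)) ^ n := by
  set α : Fin m → (Fin (K + 1) → S) → ℝ :=
    fun r z => min 1 (tensorFun μ (edgeFlowSwap (φ r) 0 (κ r).succ z) / tensorFun μ z) with hα_def
  have hα : ∀ r z, α r z = min 1 (tensorFun μ (edgeFlowSwap (φ r) 0 (κ r).succ z) / tensorFun μ z) := fun _ _ => rfl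
  set β : Fin m → (Fin (K + 1) → S) → ℝ := fun r z => (1 : ℝ) * μ (κ r).succ (φ r (z 0)) / μ 0 (z 0) with hβ_def
  have hβ : ∀ r z, β r z = (1 : ℝ) * μ (κ r).succ (φ r (z 0)) / μ 0 (z 0) := fun _ _ => rfl
  set β' : Fin m → (Fin (K + 1) → S) → ℝ :=
    fun r z => (1 : ℝ) * μ 0 ((φ r).symm (z (κ r).succ)) / μ (κ r).succ (z (κ r).succ) with hβ'_def
  have hβ' : ∀ r z, β' r z = (1 : ℝ) * μ 0 ((φ r).symm (z (κ r).succ)) / μ (κ r).succ (z (κ r).succ) :=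
    fun _ _ => rfl
  set γ : Fin m → (Fin (K + 1) → S) × Finset (Fin (K + 1)) → ℝ := fun r a =>
    if (0 : Fin (K + 1)) ∉ a.2 then (if (κ r).succ ∉ a.2 then α r a.1 else β r a.1)
      else (if (κ r).succ ∉ a.2 then β' r a.1 else 0) with hγ_def
  have hγ : ∀ r a, γ r a = if (0 : Fin (K + 1)) ∉ a.2 then (if (κ r).succ ∉ a.2 then α r a.1 else β r a.1)
      else (if (κ r).succ ∉ a.2 then β' r a.1 else 0) := fun _ _ => rfl
  set gbar : Fin m → Finset (Fin (K + 1)) → ℝ := fun r D =>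
    if (0 : Fin (K + 1)) ∉ D then (if (κ r).succ ∉ D then (1 : ℝ) else (1 : ℝ))
      else (if (κ r).succ ∉ D then (1 : ℝ) else 0) with hg_def
  have hg : ∀ r D, gbar r D = if (0 : Fin (K + 1)) ∉ D then (if (κ r).succ ∉ D then (1 : ℝ) else (1 : ℝ))
      else (if (κ r).succ ∉ D then (1 : ℝ) else 0) := fun _ _ => rfl
  set Bset : Fin m → Finset (Fin (K + 1)) → Finset (Fin (K + 1)) := fun r D =>
    if (0 : Fin (K + 1)) ∉ D ∧ (κ r).succ ∉ D then D else insert (0 : Fin (K + 1)) (insert (κ r).succ D) with hB_def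
  have hB : ∀ r D, Bset r D = if (0 : Fin (K + 1)) ∉ D ∧ (κ r).succ ∉ D then D
      else insert (0 : Fin (K + 1)) (insert (κ r).succ D) := fun _ _ => rfl
  set Ph : (Fin (K + 1) → S) × Finset (Fin (K + 1)) → (Fin (K + 1) → S) × Finset (Fin (K + 1)) → ℝ := fun a b =>
    ∑ r : Fin m, t / m *
        (γ r a * (if b.1 = edgeFlowSwap (φ r) 0 (κ r).succ a.1 ∧ b.2 = a.2.image (Equiv.swap (0 : Fin (K + 1)) (κ r).succ)
            then (1 : ℝ) else 0)
          + (α r a.1 - γ r a) * (if b.1 = edgeFlowSwap (φ r) 0 (κ r).succ a.1 ∧ b.2 = Bset r a.2 then (1 : ℝ) else 0)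
          + (1 - α r a.1) * (if b.1 = a.1 ∧ b.2 = Bset r a.2 then (1 : ℝ) else 0))
      + (1 - t) * ∑ k : Fin (K + 1), w k * (coordKernel M k a.1 b.1
          * (if b.2 = (if k = 0 then a.2.erase 0 else a.2) then (1 : ℝ) else 0)) with hPh_def
  have hPh : ∀ a b, Ph a b = ∑ r : Fin m, t / m *
        (γ r a * (if b.1 = edgeFlowSwap (φ r) 0 (κ r).succ a.1 ∧ b.2 = a.2.image (Equiv.swap (0 : Fin (K + 1)) (κ r).succ)
            then (1 : ℝ) else 0)
          + (α r a.1 - γ r a) * (if b.1 = edgeFlowSwap (φ r) 0 (κ r).succ a.1 ∧ b.2 = Bset r a.2 then (1 : ℝ) else 0)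
          + (1 - α r a.1) * (if b.1 = a.1 ∧ b.2 = Bset r a.2 then (1 : ℝ) else 0))
      + (1 - t) * ∑ k : Fin (K + 1), w k * (coordKernel M k a.1 b.1
          * (if b.2 = (if k = 0 then a.2.erase 0 else a.2) then (1 : ℝ) else 0)) := fun _ _ => rfl
  set Q : Finset (Fin (K + 1)) → Finset (Fin (K + 1)) → ℝ := fun D D' => ∑ r : Fin m, t / m *
        (gbar r D * (if D' = D.image (Equiv.swap (0 : Fin (K + 1)) (κ r).succ) then (1 : ℝ) else 0)
          + (1 - gbar r D) * (if D' = Bset r D then (1 : ℝ) else 0))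
      + (1 - t) * (w 0 * (if D' = D.erase 0 then (1 : ℝ) else 0) + (1 - w 0) * (if D' = D then (1 : ℝ) else 0)) with hQ_def
  have hQ : ∀ D D', Q D D' = ∑ r : Fin m, t / m *
        (gbar r D * (if D' = D.image (Equiv.swap (0 : Fin (K + 1)) (κ r).succ) then (1 : ℝ) else 0)
          + (1 - gbar r D) * (if D' = Bset r D then (1 : ℝ) else 0))
      + (1 - t) * (w 0 * (if D' = D.erase 0 then (1 : ℝ) else 0) + (1 - w 0) * (if D' = D then (1 : ℝ) else 0)) :=
    fun _ _ => rfl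
  have hw01 : w 0 ≤ 1 := by
    have h := Finset.single_le_sum (f := w) (fun k _ => hw0 k) (mem_univ (0 : Fin (K + 1)))
    rw [hw1] at h; exact h
  have hdom : ∀ r u, (1 : ℝ) * μ (κ r).succ (φ r u) ≤ μ 0 u := fun r u => by rw [one_mul, hperf]
  have hrev : ∀ r u, (1 : ℝ) * μ 0 u ≤ μ (κ r).succ (φ r u) := fun r u => by rw [one_mul, hperf]
  have hstale := warmStart_tvDist_le_stale κ φ hm ht0.le ht1.le hw0 hw1 hμ hμ1 hM hM0 hstat zero_le_one le_rfl zero_le_one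
    le_rfl hdom hrev hα hβ hβ' hγ hg hB hPh hQ D₀ x hg' n
  -- the drift conditions at `p = q = 1`, `b = 1 − δ`, `δ = (1−t)w_0/2`, `ρ = t(1−t)w_0c/(2m)`
  have hmpos : (0 : ℝ) < m := Nat.cast_pos.mpr (by omega)
  have hcpos : (0 : ℝ) < c := Nat.cast_pos.mpr (by omega)
  have hcm' : (c : ℝ) ≤ m := by exact_mod_cast hcm
  have hcm1 : (c : ℝ) / m ≤ 1 := (div_le_one hmpos).mpr hcm'
  set δ := (1 - t) * w 0 / 2 with hδ
  have hδ0 : 0 < δ := by rw [hδ]; exact div_pos (mul_pos (by linarith) hw00) (by norm_num)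
  have hδ1 : δ ≤ (1 - t) / 2 := by rw [hδ]; nlinarith
  set ρ := t * (1 - t) * w 0 * c / (2 * m) with hρ
  have hρδ : ρ = t * δ * (c / m) := by rw [hρ, hδ]; field_simp
  have hρ0 : 0 ≤ ρ := by rw [hρδ]; positivity
  have hρtδ : ρ ≤ t * δ := by rw [hρδ]; exact mul_le_of_le_one_right (by positivity) hcm1
  have hρ1 : ρ ≤ 1 := by nlinarith
  have h1 : ρ ≤ t * c * (1 - (1 - δ)) / m := by rw [hρδ]; apply le_of_eq; field_simp; ring
  have h3 : ρ ≤ t * (1 - 1 * (1 - δ)) * c / m := by rw [hρδ]; apply le_of_eq; field_simp; ring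
  have h2 : ρ * (1 - δ) ≤ (1 - t) * w 0 * (1 - δ) - t * (1 - 1 * (1 - δ)) := by
    have hw : (1 - t) * w 0 = 2 * δ := by rw [hδ]; ring
    rw [hw]
    nlinarith [hρtδ, hδ1, hδ0, ht0, mul_pos ht0 hδ0]
  have htag := regen_nonempty_le_from κ hm ht0.le ht1.le hw00.le hw01 le_rfl (by norm_num) le_rfl hg hB hQ hc
    (by linarith : 0 < 1 - δ) (by linarith : 1 - δ ≤ 1) hρ1 h1 h2 h3 D₀ n
  -- `Φ_b(D₀) ≤ #D₀` and `1/b ≤ 2`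
  have hΦ : ∑ k ∈ D₀, (if k = (0 : Fin (K + 1)) then 1 - δ else (1 : ℝ)) ≤ (D₀.card : ℝ) := by
    calc ∑ k ∈ D₀, (if k = (0 : Fin (K + 1)) then 1 - δ else (1 : ℝ)) ≤ ∑ _k ∈ D₀, (1 : ℝ) :=
          Finset.sum_le_sum fun k _ => by split_ifs <;> linarith
      _ = (D₀.card : ℝ) := by rw [sum_const, nsmul_eq_mul, mul_one]
  have hb : (1 : ℝ) / 2 ≤ 1 - δ := by linarith
  refine hstale.trans (htag.trans ?_)
  rw [div_le_iff₀ (by linarith : (0 : ℝ) < 1 - δ)]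
  have hpow : 0 ≤ (1 - ρ) ^ n := pow_nonneg (by linarith) n
  have hD : (0 : ℝ) ≤ D₀.card := Nat.cast_nonneg _
  calc (1 - ρ) ^ n * ∑ k ∈ D₀, (if k = (0 : Fin (K + 1)) then 1 - δ else (1 : ℝ))
      ≤ (1 - ρ) ^ n * (D₀.card : ℝ) := mul_le_mul_of_nonneg_left hΦ hpow
    _ ≤ 2 * (D₀.card : ℝ) * (1 - ρ) ^ n * (1 - δ) := by nlinarith [mul_nonneg hpow hD]

end WarmPerfect

end Summit.Ventures.LatticeQCDFlow.Scaling

end
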